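import Summits.QuantumFields.YangMills.Theses.MarkovAtoms
import Summits.QuantumFields.YangMills.Theorems.MarkovAtomsMarkovHolder
import Summits.QuantumFields.YangMills.Theorems.BalabanLadderNTBoundaryLawCore
import Summits.QuantumFields.YangMills.Theorems.BalabanLadderInfVolTranslations
import Summits.QuantumFields.YangMills.Theorems.OnsetSkewLawOnsetVanishing
import Summits.QuantumFields.YangMills.Theorems.LangevinControlUVOSLegsFromFemtoAndGapStubLowerMoments
import HarnessLib

/-!
# `stub_markovTail` of LINE «MarkovFloorInheritance» — PROVED
# (crux `MarkovAtoms.OnsetFloor`, stmt-QuantumFields-22956; registered stub `stub_markovTail : StubMarkovTailP`)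

The tail of the line «MarkovFloorInheritance» on the crux `MarkovAtoms.OnsetFloor`: for an ADMISSIBLE COLLAR BUMP `(b, R₀, t)`
(`AdmBump`: compact support in `[0,R₀]⁴ ∩ {u₀ > 0}`, `∫ b ≠ 0`, permutation symmetric, time-symmetric about `t/2`), a collar
parameter `0 < Λ₀ ≤ 1/2`, ANY `β`, any odd-torus limit state `μ`, and a COARSE POSITIVE-TIME COLLAR ATOM `(q, s ≤ 1, y)` (`q.1 < q.2`,
`0 ≤ y₀`, collar inequality `R₀ + 1 + 9s ≤ 2y₀ + t`), there is an offset `y'` IN THE CELL `[0,s]⁴` with `|rpSq {q} s y| ≤ V q s y'`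
— the RP square of `OnsetSkewLaw.RPOnsetFloor` is dominated by the conditional-mean variance functional `V` of `MarkovAtoms.OnsetFloor`.

Proof = MarkovHolder (`MarkovAtoms.MarkovHolder`, stmt-QuantumFields-22740, landed `markovHolder_proof`) with `n = 2` applied to the
atom and its time mirror, plus bookkeeping, all in this module:
1. `mirrorOffset`, `mirror_weight` — reflected weight = weight at the mirror offset `y_m = (−(t+y₀), y⃗)`.
2. `cubes_separated_of_collar` — the collar inequality gives MarkovHolder's separation clause (axis 0) for the two crux-cubes.
3. `condVar` (= the crux's `V`, `condVar_eq` by `rfl`), `condVar_translate` — `ℤ⁴`-covariance of `V` in odd-torus limit states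
   (tree `kerE_configShift`, `plane_configShift`, `isZdTranslationInvariant_of_mem_oddTorusLimitPoints`, `integral_comp_configShift`).
4. `atomSites`, `bumpAtom_eq_sum`, `continuous_bumpAtom`, `abs_bumpAtom_le`, `isCylinder_bumpAtom` — the atom is a finite sum, hence
   a bounded continuous cylinder observable on its crux-cube (MarkovHolder's hypotheses).
5. `rpSq_eq_integral_centred` — `rpSq {q} s y = ∫ (F_{y_m} − E F_{y_m})(F_y − E F_y) dμ` (finite double sum × `stateMomentStr_two`).
6. `markovHolder_two` — the `n = 2` instance of `markovHolder_proof`.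
7. `markovTail_core`, `stub_markovTail` — `rpSq² ≤ V(y_m)·V(y) ≤ max² ⇒ |rpSq| ≤ V(y*)`, then the cell representative
   `y' = y* − s⌊y*/s⌋` with `V(y') = V(y*)`.

Planner ym-idea-11 g13 (for a free hand to land `--supports stmt-QuantumFields-22956`).  HONEST LABEL: this closes ONE registered
M-stub of one line on one crux; no crux / rung / summit is proved; the Yang–Mills mass gap is NOT proved.
-/

set_option autoImplicit false

noncomputable section

open MeasureTheory
open scoped BigOperators
open Literature.MathematicalPhysics.QuantumFieldTheory hiding ZdEdge
open Literature.MathematicalPhysics.QuantumLattice hiding cubeEdges cubeSites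
open Literature.Probability.LatticeModels (Site)
open Summit.QuantumFields.YangMills.Theorems.InfiniteVolume Summit.QuantumFields.YangMills.Theorems.InfVolRP
open Summit.QuantumFields.YangMills.Cruxes.OSLegsFromFemtoAndGap.DlrCollarTransfer
open Summit.QuantumFields.YangMills.Cruxes.NT.BoundaryLaw (kerE_configShift plane_configShift configShift_configShift)
open Summit.QuantumFields.YangMills.Theorems.OnsetSkewLawGlue (abs_plane_le_N)
open Summit.QuantumFields.YangMills.Theorems.OSLegsFromFemtoAndGap.StubLower (integrable_of_continuous_compact)
open Summit.QuantumFields.YangMills.Theorems.OnsetTautologyOnsetContraction (stateMomentStr_two)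


/-! Landing note (prover ym-line-sfw-p2-w2 g26, 2026-08-29): this is the planner's module
`pub/ideators/ym-idea-11/g13/MarkovAtomsOnsetFloorMarkovTail.lean` (planner ym-idea-11 g13, 612 lines, rc 0 /
0 sorry) landed verbatim in TWO files for the 400-line rule — this file = §§ Collar / CondVar / Atom (items 1–4 of
the list above); `MarkovAtomsOnsetFloorMarkovTail.lean` = §§ RPSquare / MarkovHolderTwo / Tail (items 5–7 and the
registered stub `stub_markovTail`). Names and namespace unchanged. -/

namespace Summit.QuantumFields.YangMills.Theorems.MarkovAtomsOnsetFloorMarkovTail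

section Collar


/-- The mirror offset `y_m = (−(t + y₀), y₁, y₂, y₃)` of an offset `y` for a bump time-symmetric about height `t/2`. [folklore] -/
def mirrorOffset (t : ℝ) (y : EuclideanSpace ℝ (Fin 4)) : EuclideanSpace ℝ (Fin 4) :=
  WithLp.toLp 2 fun i => if i = 0 then -(t + y 0) else y i

/-- Helper. [folklore] -/
@[simp] theorem mirrorOffset_apply_zero (t : ℝ) (y : EuclideanSpace ℝ (Fin 4)) :
    mirrorOffset t y 0 = -(t + y 0) := by
  simp [mirrorOffset]

/-- **Reflected weight = weight at the mirror offset.**  If `b (t − u₀, u⃗) = b u` for all `u`, then for all `w, y`: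
`b (θ w − y) = b (w − y_m)`. [folklore] -/
theorem mirror_weight (b : EuclideanSpace ℝ (Fin 4) → ℝ) (t : ℝ)
    (hsym : ∀ u : EuclideanSpace ℝ (Fin 4), b (WithLp.toLp 2 fun i => if i = 0 then t - u i else u i) = b u)
    (w y : EuclideanSpace ℝ (Fin 4)) :
    b (timeReflection 4 w - y) = b (w - mirrorOffset t y) := by
  have key : (WithLp.toLp 2 fun i => if i = 0 then t - (w - mirrorOffset t y) i else (w - mirrorOffset t y) i :
      EuclideanSpace ℝ (Fin 4)) = timeReflection 4 w - y := by
    ext i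
    by_cases hi : i = 0
    · subst hi
      simp [timeReflection_apply, mirrorOffset]
      ring
    · simp [timeReflection_apply, mirrorOffset, hi]
  rw [← key]
  exact hsym _

/-- **Collar inequality ⇒ cube separation.**  With `0 < s`, `0 < Λ₀ ≤ 1/2`, `0 ≤ R₀` and `R₀ + 1 + 9s ≤ 2y₀ + t`, the
crux-cube of the mirror atom (time corner `⌊−(t+y₀)/s⌋ − ⌈Λ₀/s⌉₊ − 1`, side `N`) lies a full lattice layer below the crux-cube of
the atom (time corner `⌊y₀/s⌋ − ⌈Λ₀/s⌉₊ − 1`): MarkovHolder's clause `c₁ 0 + N + 1 ≤ c₂ 0`. [folklore] -/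
theorem cubes_separated_of_collar {s R₀ Λ₀ t y₀ : ℝ} (hs : 0 < s) (hΛ : 0 < Λ₀) (hΛ2 : Λ₀ ≤ 1 / 2)
    (hR : 0 ≤ R₀) (hcol : R₀ + 1 + 9 * s ≤ 2 * y₀ + t) :
    (⌊-(t + y₀) / s⌋ - (⌈Λ₀ / s⌉₊ : ℕ) - 1 : ℤ) + ((⌈R₀ / s⌉₊ + 2 * ⌈Λ₀ / s⌉₊ + 4 : ℕ) : ℤ) + 1 ≤
      ⌊y₀ / s⌋ - (⌈Λ₀ / s⌉₊ : ℕ) - 1 := by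
  -- real-number bounds on the floors / ceilings, multiplied through by `s > 0`
  have hA : ((⌊-(t + y₀) / s⌋ : ℤ) : ℝ) * s ≤ -(t + y₀) :=
    (le_div_iff₀ hs).mp (Int.floor_le _)
  have hRc : (((⌈R₀ / s⌉₊ : ℕ) : ℝ) - 1) * s < R₀ := by
    have h := Nat.ceil_lt_add_one (div_nonneg hR hs.le)
    have h' : ((⌈R₀ / s⌉₊ : ℕ) : ℝ) - 1 < R₀ / s := by linarith
    exact (lt_div_iff₀ hs).mp h'
  have hL : (((⌈Λ₀ / s⌉₊ : ℕ) : ℝ) - 1) * s < Λ₀ := by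
    have h := Nat.ceil_lt_add_one (div_nonneg hΛ.le hs.le)
    have h' : ((⌈Λ₀ / s⌉₊ : ℕ) : ℝ) - 1 < Λ₀ / s := by linarith
    exact (lt_div_iff₀ hs).mp h'
  have hB : y₀ < (((⌊y₀ / s⌋ : ℤ) : ℝ) + 1) * s :=
    (div_lt_iff₀ hs).mp (Int.lt_floor_add_one _)
  -- combine: (A + Rc + 2L + 5)·s < B·s
  have hlt : (((⌊-(t + y₀) / s⌋ : ℤ) : ℝ) + ((⌈R₀ / s⌉₊ : ℕ) : ℝ) + 2 * ((⌈Λ₀ / s⌉₊ : ℕ) : ℝ) + 5) * s <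
      (((⌊y₀ / s⌋ : ℤ) : ℝ)) * s := by
    nlinarith
  have hlt' : ((⌊-(t + y₀) / s⌋ : ℤ) : ℝ) + ((⌈R₀ / s⌉₊ : ℕ) : ℝ) + 2 * ((⌈Λ₀ / s⌉₊ : ℕ) : ℝ) + 5 <
      ((⌊y₀ / s⌋ : ℤ) : ℝ) := lt_of_mul_lt_mul_right hlt hs.le
  have hZ : (⌊-(t + y₀) / s⌋ : ℤ) + ((⌈R₀ / s⌉₊ : ℕ) : ℤ) + 2 * ((⌈Λ₀ / s⌉₊ : ℕ) : ℤ) + 5 < ⌊y₀ / s⌋ := by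
    exact_mod_cast hlt'
  push_cast
  omega


end Collar

section CondVar


variable (G : Type) [Group G] [TopologicalSpace G] [IsTopologicalGroup G] [CompactSpace G]
  [MeasurableSpace G] [BorelSpace G]

/-- The conditional-mean variance functional of the crux `MarkovAtoms.OnsetFloor` (its `let V`, verbatim body):
`V q s y = ∫ (E[F_y | crux-cube exterior](η) − E_μ F_y)² dμ(η)` with `F_y = Σ_x b(s(x + o_q) − y)·plane_q(x)`, crux-cube corner
`⌊y_j/s⌋ − ⌈Λ₀/s⌉₊ − 1` and side parameter `⌈R₀/s⌉₊ + 2⌈Λ₀/s⌉₊ + 4`. [folklore] -/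
def condVar (r : LatticeRep G) (β : ℝ) (μ : Measure (LGConfig 4 G)) (b : EuclideanSpace ℝ (Fin 4) → ℝ) (Λ₀ R₀ : ℝ)
    (q : Fin 4 × Fin 4) (s : ℝ) (y : EuclideanSpace ℝ (Fin 4)) : ℝ :=
  ∫ η, (kerE G r β (fun j => ⌊y j / s⌋ - (⌈Λ₀ / s⌉₊ : ℕ) - 1) (⌈R₀ / s⌉₊ + 2 * ⌈Λ₀ / s⌉₊ + 4) η
      (fun U => ∑' x : Fin 4 → ℤ, b (s • (siteToE x + centreOffset q) - y) * plane G r q x U) -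
    ∫ U, (∑' x : Fin 4 → ℤ, b (s • (siteToE x + centreOffset q) - y) * plane G r q x U) ∂μ) ^ 2 ∂μ

omit [Group G] [TopologicalSpace G] [IsTopologicalGroup G] [CompactSpace G] [BorelSpace G] in
/-- Helper. [folklore] -/
private theorem configShift_zero' (U : LGConfig 4 G) : configShift (0 : Site 4) U = U := by
  funext e
  simp [configShift_apply]

/-- Helper. [folklore] -/
private theorem siteToE_add' (x k : Fin 4 → ℤ) : siteToE (d := 4) (x + k) = siteToE x + siteToE k := by
  ext j
  simp [siteToE_apply]

/-- **`ℤ⁴`-covariance of `V`.**  For an odd-torus limit state, translating the offset by a lattice vector (scaled by the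
spacing `s ≠ 0`) does not change the conditional-mean variance: `V q s (y + s•k) = V q s y`. [folklore] -/
theorem condVar_translate (r : LatticeRep G) {β : ℝ} {μ : Measure (LGConfig 4 G)} (hμ : μ ∈ oddTorusLimitPoints r β)
    (b : EuclideanSpace ℝ (Fin 4) → ℝ) (Λ₀ R₀ : ℝ) (q : Fin 4 × Fin 4) {s : ℝ} (hs : s ≠ 0)
    (y : EuclideanSpace ℝ (Fin 4)) (k : Fin 4 → ℤ) :
    condVar G r β μ b Λ₀ R₀ q s (y + s • siteToE k) = condVar G r β μ b Λ₀ R₀ q s y := by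
  have hμT : IsZdTranslationInvariant μ := isZdTranslationInvariant_of_mem_oddTorusLimitPoints r hμ
  unfold condVar
  -- fold the data of the UNshifted side: observable `F`, corner `c`, side parameter `N`
  set F : LGConfig 4 G → ℝ := fun U => ∑' x : Fin 4 → ℤ, b (s • (siteToE x + centreOffset q) - y) * plane G r q x U
    with hFdef
  set c : Fin 4 → ℤ := fun j => ⌊y j / s⌋ - (⌈Λ₀ / s⌉₊ : ℕ) - 1 with hcdef
  set N : ℕ := ⌈R₀ / s⌉₊ + 2 * ⌈Λ₀ / s⌉₊ + 4 with hNdef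
  -- (1) the corner moves by `k`
  have hc : (fun j => ⌊(y + s • siteToE k) j / s⌋ - (⌈Λ₀ / s⌉₊ : ℕ) - 1 : Fin 4 → ℤ) = c + k := by
    funext j
    have h1 : (y + s • siteToE k) j / s = y j / s + (k j : ℝ) := by
      have : (y + s • siteToE k) j = y j + s * (k j : ℝ) := by
        simp [siteToE_apply]
      rw [this, add_div, mul_div_cancel_left₀ _ hs]
    simp only [Pi.add_apply, hcdef, h1, Int.floor_add_intCast]
    ring
  -- (2) the observable at the shifted offset is the old one composed with `configShift (-k)`
  have hF : (fun U => ∑' x : Fin 4 → ℤ, b (s • (siteToE x + centreOffset q) - (y + s • siteToE k)) * plane G r q x U) =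
      fun U => F (configShift (-k) U) := by
    funext U
    rw [hFdef]
    simp only
    rw [← (Equiv.addRight k).tsum_eq]
    refine tsum_congr fun x => ?_
    show b (s • (siteToE (x + k) + centreOffset q) - (y + s • siteToE k)) * plane G r q (x + k) U = _
    have hx : s • (siteToE (x + k) + centreOffset q) - (y + s • siteToE k) = s • (siteToE x + centreOffset q) - y := by
      rw [siteToE_add', smul_add, smul_add, smul_add]
      abel
    have hp : plane G r q (x + k) U = plane G r q x (configShift (-k) U) := by
      have h := plane_configShift G r k q x (configShift (-k) U)
      rwa [configShift_configShift, add_neg_cancel, configShift_zero'] at h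
    rw [hx, hp]
  -- (3) the mean is unchanged
  have hmean : ∫ U, F (configShift (-k) U) ∂μ = ∫ U, F U ∂μ := integral_comp_configShift hμT (-k) F
  -- (4) the kernel of the shifted cube on the shifted observable = the old kernel at the back-shifted exterior
  have hker : ∀ η : LGConfig 4 G,
      kerE G r β (c + k) N η (fun U => F (configShift (-k) U)) = kerE G r β c N (configShift (-k) η) F := by
    intro η
    have h := kerE_configShift G r k β c N (configShift (-k) η) (fun U => F (configShift (-k) U))
    rw [configShift_configShift, add_neg_cancel, configShift_zero'] at h
    rw [h]
    congr 1
    funext U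
    simp only [Function.comp_apply]
    rw [configShift_configShift, neg_add_cancel, configShift_zero']
  -- assemble
  rw [hc, hF, hmean]
  simp_rw [hker]
  exact integral_comp_configShift hμT (-k) (fun η => (kerE G r β c N η F - ∫ U, F U ∂μ) ^ 2)


end CondVar

section Atom


/-- The sites that can carry a non-zero weight `b(s(x + o_q) − y)` when `b` is supported in `[0, R₀]⁴`:
`x_j ∈ [⌊y_j/s⌋, ⌊y_j/s⌋ + ⌈R₀/s⌉₊]`. [folklore] -/
def atomSites (R₀ s : ℝ) (y : EuclideanSpace ℝ (Fin 4)) : Finset (Fin 4 → ℤ) :=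
  Fintype.piFinset fun j => Finset.Icc ⌊y j / s⌋ (⌊y j / s⌋ + ⌈R₀ / s⌉₊)

/-- Coordinates of the plaquette-centre offsets lie in `[0, 1/2]`. [folklore] -/
theorem centreOffset_apply_mem (q : Fin 4 × Fin 4) (j : Fin 4) :
    0 ≤ centreOffset q j ∧ centreOffset q j ≤ 1 / 2 := by
  unfold centreOffset
  split_ifs with h
  · have hne : q.1 ≠ q.2 := ne_of_lt h
    by_cases h1 : j = q.1
    · subst h1
      simp [hne]
    · by_cases h2 : j = q.2
      · subst h2
        simp [h1]
      · simp [h1, h2]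
  · simp

/-- Off `atomSites R₀ s y` the weight vanishes. [folklore] -/
theorem weight_eq_zero_of_not_mem (b : EuclideanSpace ℝ (Fin 4) → ℝ) {R₀ : ℝ}
    (hbR : tsupport b ⊆ {u | ∀ j, 0 ≤ u j ∧ u j ≤ R₀}) {s : ℝ} (hs : 0 < s) (q : Fin 4 × Fin 4)
    (y : EuclideanSpace ℝ (Fin 4)) {x : Fin 4 → ℤ} (hx : x ∉ atomSites R₀ s y) :
    b (s • (siteToE x + centreOffset q) - y) = 0 := by
  by_contra hne
  have hmem : s • (siteToE x + centreOffset q) - y ∈ tsupport b := subset_tsupport _ (Function.mem_support.2 hne)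
  have hbox := hbR hmem
  apply hx
  rw [atomSites, Fintype.mem_piFinset]
  intro j
  rw [Finset.mem_Icc]
  obtain ⟨h0, h1⟩ := hbox j
  have hc := centreOffset_apply_mem q j
  have hcoord : (s • (siteToE x + centreOffset q) - y) j = s * ((x j : ℝ) + centreOffset q j) - y j := by
    simp [siteToE_apply, mul_add]
  rw [hcoord] at h0 h1
  have hfl := Int.floor_le (y j / s)
  have hlt := Int.lt_floor_add_one (y j / s)
  have hceil := Nat.le_ceil (R₀ / s)
  have hys : (⌊y j / s⌋ : ℝ) * s ≤ y j := (le_div_iff₀ hs).mp hfl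
  have hys' : y j < ((⌊y j / s⌋ : ℝ) + 1) * s := (div_lt_iff₀ hs).mp hlt
  have hRs : R₀ ≤ (⌈R₀ / s⌉₊ : ℝ) * s := (div_le_iff₀ hs).mp hceil
  constructor
  · have hlt' : ((⌊y j / s⌋ : ℤ) : ℝ) - 1 < (x j : ℝ) := by nlinarith [hc.2]
    have : ⌊y j / s⌋ - 1 < x j := by exact_mod_cast hlt'
    omega
  · have hlt' : (x j : ℝ) < ((⌊y j / s⌋ : ℤ) : ℝ) + ((⌈R₀ / s⌉₊ : ℕ) : ℝ) + 1 := by nlinarith [hc.1]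
    have : x j < ⌊y j / s⌋ + ((⌈R₀ / s⌉₊ : ℕ) : ℤ) + 1 := by exact_mod_cast hlt'
    omega

variable (G : Type) [Group G] [TopologicalSpace G] [IsTopologicalGroup G] [CompactSpace G]
  [MeasurableSpace G] [BorelSpace G] (r : LatticeRep G)

omit [IsTopologicalGroup G] [CompactSpace G] [BorelSpace G] in
/-- **The atom is a finite sum** over `atomSites R₀ s y`. [folklore] -/
theorem bumpAtom_eq_sum (b : EuclideanSpace ℝ (Fin 4) → ℝ) {R₀ : ℝ}
    (hbR : tsupport b ⊆ {u | ∀ j, 0 ≤ u j ∧ u j ≤ R₀}) {s : ℝ} (hs : 0 < s) (q : Fin 4 × Fin 4)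
    (y : EuclideanSpace ℝ (Fin 4)) :
    (fun U : LGConfig 4 G => ∑' x : Fin 4 → ℤ, b (s • (siteToE x + centreOffset q) - y) * plane G r q x U) =
      fun U => ∑ x ∈ atomSites R₀ s y, b (s • (siteToE x + centreOffset q) - y) * plane G r q x U := by
  funext U
  exact tsum_eq_sum fun x hx => by rw [weight_eq_zero_of_not_mem b hbR hs q y hx, zero_mul]

omit [CompactSpace G] [BorelSpace G] in
/-- The atom is continuous. [folklore] -/
theorem continuous_bumpAtom (b : EuclideanSpace ℝ (Fin 4) → ℝ) {R₀ : ℝ}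
    (hbR : tsupport b ⊆ {u | ∀ j, 0 ≤ u j ∧ u j ≤ R₀}) {s : ℝ} (hs : 0 < s) (q : Fin 4 × Fin 4)
    (y : EuclideanSpace ℝ (Fin 4)) :
    Continuous (fun U : LGConfig 4 G => ∑' x : Fin 4 → ℤ, b (s • (siteToE x + centreOffset q) - y) * plane G r q x U) := by
  rw [bumpAtom_eq_sum G r b hbR hs q y]
  exact continuous_finsetSum _ fun x _ => continuous_const.mul (continuous_plane r q x)

omit [BorelSpace G] in
/-- The atom is bounded by `(Σ_{x ∈ atomSites} |b(s(x + o_q) − y)|) · N`. [folklore] -/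
theorem abs_bumpAtom_le (b : EuclideanSpace ℝ (Fin 4) → ℝ) {R₀ : ℝ}
    (hbR : tsupport b ⊆ {u | ∀ j, 0 ≤ u j ∧ u j ≤ R₀}) {s : ℝ} (hs : 0 < s) (q : Fin 4 × Fin 4)
    (y : EuclideanSpace ℝ (Fin 4)) (U : LGConfig 4 G) :
    |∑' x : Fin 4 → ℤ, b (s • (siteToE x + centreOffset q) - y) * plane G r q x U| ≤
      (∑ x ∈ atomSites R₀ s y, |b (s • (siteToE x + centreOffset q) - y)|) * r.N := by
  have h := congrFun (bumpAtom_eq_sum G r b hbR hs q y) U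
  rw [h, Finset.sum_mul]
  refine (Finset.abs_sum_le_sum_abs _ _).trans (Finset.sum_le_sum fun x _ => ?_)
  rw [abs_mul]
  exact mul_le_mul_of_nonneg_left (abs_plane_le_N r q x U) (abs_nonneg _)

omit [IsTopologicalGroup G] [CompactSpace G] [BorelSpace G] in
/-- **The atom is a cylinder observable on its crux-cube**: corner `⌊y_j/s⌋ − ⌈Λ₀/s⌉₊ − 1`, side
`⌈R₀/s⌉₊ + 2⌈Λ₀/s⌉₊ + 4` (the cube data of the `V` of `MarkovAtoms.OnsetFloor`), for every `Λ₀`. [folklore] -/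
theorem isCylinder_bumpAtom (b : EuclideanSpace ℝ (Fin 4) → ℝ) {R₀ : ℝ}
    (hbR : tsupport b ⊆ {u | ∀ j, 0 ≤ u j ∧ u j ≤ R₀}) {s : ℝ} (hs : 0 < s) (q : Fin 4 × Fin 4)
    (y : EuclideanSpace ℝ (Fin 4)) (Λ₀ : ℝ) :
    IsCylinder (fun U : LGConfig 4 G => ∑' x : Fin 4 → ℤ, b (s • (siteToE x + centreOffset q) - y) * plane G r q x U)
      (cubeEdges (fun j => ⌊y j / s⌋ - (⌈Λ₀ / s⌉₊ : ℕ) - 1) (⌈R₀ / s⌉₊ + 2 * ⌈Λ₀ / s⌉₊ + 4)) := by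
  rw [bumpAtom_eq_sum G r b hbR hs q y]
  intro U V hUV
  refine Finset.sum_congr rfl fun x hx => congrArg _ (isCylinder_plane r q x fun e he => hUV e ?_)
  have h01 := near_of_mem_supp_plane (Finset.mem_coe.1 he)
  rw [atomSites, Fintype.mem_piFinset] at hx
  rw [Finset.mem_coe]
  unfold cubeEdges cubeSites
  simp only [Finset.mem_filter, Finset.mem_product, Finset.mem_univ, and_true, Fintype.mem_piFinset,
    Finset.mem_Ico, Pi.add_apply, Pi.single_apply]
  refine ⟨fun j => ?_, fun j => ?_⟩
  · obtain ⟨h0, h1⟩ := h01 j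
    have hxj := Finset.mem_Icc.1 (hx j)
    push_cast
    omega
  · obtain ⟨h0, h1⟩ := h01 j
    have hxj := Finset.mem_Icc.1 (hx j)
    split_ifs <;> push_cast <;> omega


end Atom
end Summit.QuantumFields.YangMills.Theorems.MarkovAtomsOnsetFloorMarkovTail

end
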